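import Mathlib
import Summits.ValiantsHypothesis.ValiantsHypothesis.Theorems.BarrierLeverPartitionMinorsHitByVPSimplexJoinBoxGameMultiCubeLaw

/-!
# Route BarrierLever — item `PartitionMinorsHitByVP` (stmt-ValiantsHypothesis-19717), line `hidden_states`:
# THE SQUARE DRAIN — the first exactly-tight DYNAMIC law of the box game: `k` disjoint squares are dead up to `r ≤ hd + 2k − 1`

Helper file (`--supports stmt-ValiantsHypothesis-19717`; cell valiant-natproofs, rung V4, 𝒟-side door (c), line
`Cruxes/PartitionMinorsHitByVP/Lines/hidden_states.lean` v8, registered stub `stub_simplexPairLower`; prover seat val-np-p3 gen 15).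
Definition-free. Closes NO item. Sequel of p665496 (`…BoxGameMultiCubeLaw`: the STATIC law `r ≤ hd + k` for `k` disjoint squares).

THE LAW (`not_boxWinning_squares_drain`, crude floor p647518). For every box-game winning predicate `W`: if the position `e` contains `k ≥ 1`
column-disjoint 2×2 squares (each inside one piece, slots reading the row or the column index), `r ≤ hd + 2k − 1` and `r + 2k + 4 ≤ 2·hd`,
then `¬ W hd r e`. The exact solver of val-np-p3 g14/g15 (lab/game.py, lab/probe4.py) gives `v*(n, k squares + units) = n + 2k` for
`n ≥ 2k + 2`: the law is TIGHT, and it exceeds the static threshold `hd + k` of p665496 by exactly `k − 1` — the multi-round DRAIN of memo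
val-np-p3 g15 §2/§7, here a kernel theorem for the first time.

MECHANISM (adversary induction on `k`; no linear algebra beyond the static base). At `hd + k + 1 < r ≤ hd + 2k − 1` the demand
`(r−3, 3)` is legal. Under any one-slot cut a square's four columns are coloured in pairs (the partner obtained by flipping the coordinate the
chosen slot does NOT read has the same colour), so a square meets the 3-column `true` child in 0, 2 or 4 columns; two squares meeting it, or one
square meeting it twice over, would put four distinct columns into a 3-column child. Hence ALL BUT AT MOST ONE square land intact in the
`false` child `(hd−1, r−3)`, which therefore contains `k−1` disjoint squares at `r − 3 ≤ (hd−1) + 2(k−1) − 1`: induction on `k`. The base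
`r ≤ hd + k` (in particular `k = 1`) is the static multi-cube law `not_boxWinning_cubes` (p665496) at `t = 1`.

WHAT THIS IS NOT: a necessary condition on (crude-floor) winning predicates; the sharp-floor twin is the same induction with the layer-cake
bound `S(hd,r) ≤ 2r − hd − 2` (not typed here); `Stmt.simplexPairLower` and item 19717 stay OPEN; nothing on crux 14610 or VP ≠ VNP.
-/

set_option linter.dupNamespace false

namespace Summit.ValiantsHypothesis.ValiantsHypothesis.Theorems.BarrierLever.SimplexJoin.Cut

open Finset Matrix
open Summit.ValiantsHypothesis.ValiantsHypothesis.Theorems.BarrierLever.HiddenStates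

noncomputable section

/-- `2·n ≤ 2^(n−1)` for `n ≥ 4`. -/
theorem two_mul_le_two_pow_pred (n : ℕ) (hn : 4 ≤ n) : 2 * n ≤ 2 ^ (n - 1) := by
  induction n, hn using Nat.le_induction with
  | base => norm_num
  | succ n hn ih =>
    have h2 : 2 ^ (n + 1 - 1) = 2 * 2 ^ (n - 1) := by
      rw [show n + 1 - 1 = (n - 1) + 1 by omega, pow_succ]; ring
    rw [h2]; omega

/-- Four pairwise distinct elements cannot all lie in the range of a map from `Fin 3`. -/
theorem not_four_mem_range_fin_three {r : ℕ} (g : Fin 3 → Fin r) (x₁ x₂ x₃ x₄ : Fin r)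
    (h12 : x₁ ≠ x₂) (h13 : x₁ ≠ x₃) (h14 : x₁ ≠ x₄) (h23 : x₂ ≠ x₃) (h24 : x₂ ≠ x₄) (h34 : x₃ ≠ x₄)
    (h1 : x₁ ∈ Set.range g) (h2 : x₂ ∈ Set.range g) (h3 : x₃ ∈ Set.range g) (h4 : x₄ ∈ Set.range g) : False := by
  classical
  have hsub : ({x₁, x₂, x₃, x₄} : Finset (Fin r)) ⊆ Finset.univ.image g := by
    intro x hx
    simp only [Finset.mem_insert, Finset.mem_singleton] at hx
    rcases hx with rfl | rfl | rfl | rfl <;>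
      first
      | exact Finset.mem_image.mpr (by obtain ⟨j, hj⟩ := h1; exact ⟨j, Finset.mem_univ _, hj⟩)
      | exact Finset.mem_image.mpr (by obtain ⟨j, hj⟩ := h2; exact ⟨j, Finset.mem_univ _, hj⟩)
      | exact Finset.mem_image.mpr (by obtain ⟨j, hj⟩ := h3; exact ⟨j, Finset.mem_univ _, hj⟩)
      | exact Finset.mem_image.mpr (by obtain ⟨j, hj⟩ := h4; exact ⟨j, Finset.mem_univ _, hj⟩)
  have hcard4 : ({x₁, x₂, x₃, x₄} : Finset (Fin r)).card = 4 := by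
    rw [Finset.card_insert_of_notMem (by simp [h12, h13, h14]), Finset.card_insert_of_notMem (by simp [h23, h24]),
      Finset.card_insert_of_notMem (by simp [h34]), Finset.card_singleton]
  have hle := Finset.card_le_card hsub
  have him : (Finset.univ.image g).card ≤ 3 := by
    calc (Finset.univ.image g).card ≤ (Finset.univ : Finset (Fin 3)).card := Finset.card_image_le
      _ = 3 := by simp
  omega

/-- **THE SQUARE DRAIN (crude floor).** For every box-game winning predicate `W` (p647518) and every `k ≥ 1`: a position containing `k`
column-disjoint 2×2 squares (square `l` = columns `i l z`, `z : Fin 2 → Fin 2`, inside one piece, every slot reading one coordinate) is NOT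
a `W`-position whenever `r ≤ hd + 2k − 1` and `r + 2k + 4 ≤ 2·hd`. Tight: `k` squares plus units win the sharp- and crude-floor game
exactly from `v = hd + 2k` on (val-np-p3 g15 exact census). -/
theorem not_boxWinning_squares_drain {m D N : ℕ}
    (W : (hd : ℕ) → (r : ℕ) → (Fin r → Fin m × (Fin D → Option (Fin N))) → Prop)
    (hwin : ∀ (hd r : ℕ) (e : Fin r → Fin m × (Fin D → Option (Fin N))), W hd r e → 2 ≤ r → 1 ≤ hd →
      ∀ r₀ r₁ : ℕ, r₀ + r₁ = r → (r - 2) / hd + 1 ≤ r₁ → r₁ ≤ r₀ → r₀ ≤ 2 ^ (hd - 1) →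
        ∃ (f : Fin m → Fin D) (side : Fin m → Option (Fin N) → Bool) (g₀ : Fin r₀ → Fin r) (g₁ : Fin r₁ → Fin r),
          Function.Injective (Sum.elim g₀ g₁) ∧
          (∀ j, side (e (g₀ j)).1 ((e (g₀ j)).2 (f (e (g₀ j)).1)) = false) ∧
          (∀ j, side (e (g₁ j)).1 ((e (g₁ j)).2 (f (e (g₁ j)).1)) = true) ∧
          W (hd - 1) r₀ (fun j => e (g₀ j)) ∧ W (hd - 1) r₁ (fun j => e (g₁ j))) :
    ∀ (k : ℕ), 1 ≤ k → ∀ (r hd : ℕ) (e : Fin r → Fin m × (Fin D → Option (Fin N))) (i : Fin k → (Fin (1 + 1) → Fin 2) → Fin r),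
      r ≤ hd + 2 * k - 1 → r + 2 * k + 4 ≤ 2 * hd →
      (Function.Injective fun lz : Fin k × (Fin (1 + 1) → Fin 2) => i lz.1 lz.2) →
      (∀ l z, (e (i l z)).1 = (e (i l fun _ => 0)).1) →
      (∀ l (φ : Fin D), ∃ c : Fin (1 + 1), ∀ z z', z c = z' c → (e (i l z)).2 φ = (e (i l z')).2 φ) →
      ¬ W hd r e := by
  intro k
  induction k with
  | zero => intro hk; omega
  | succ k IHk =>
  intro _ r hd e i hr hbud hinj hpiece hsq hW
  classical
  -- the static zone `r ≤ hd + k + 1` is the multi-cube law at `t = 1`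
  have hB1 : (∑ j ∈ Finset.range (1 + 1), hd.choose j) = 1 + hd := by
    simp [Finset.sum_range_succ]
  have hB2 : (∑ j ∈ Finset.range (1 + 2), hd.choose j) = 1 + hd + hd.choose 2 := by
    rw [show (1 + 2 : ℕ) = 3 from rfl]
    simp [Finset.sum_range_succ, Nat.choose_zero_right, Nat.choose_one_right]
  by_cases hstatic : r < 1 + hd + (k + 1)
  · have hk3 : k + 3 ≤ hd := by omega
    have hc : 2 * k ≤ hd.choose 2 := by
      rw [Nat.choose_two_right, Nat.le_div_iff_mul_le (by norm_num)]
      have h1 : (k + 3) * (k + 2) ≤ hd * (hd - 1) := Nat.mul_le_mul hk3 (by omega)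
      nlinarith
    have hr1 : r < (∑ j ∈ Finset.range (1 + 1), hd.choose j) + (k + 1) := by rw [hB1]; exact hstatic
    have hr2 : r ≤ ∑ j ∈ Finset.range (1 + 2), hd.choose j := by rw [hB2]; omega
    exact not_boxWinning_cubes W hwin 1 (k + 1) (by omega) r hd e i hr1 hr2 hinj hpiece hsq hW
  -- the dynamic zone: `hd + k + 2 ≤ r ≤ hd + 2k + 1`, so `k ≥ 1`, `hd ≥ 3k + 8`, `r ≥ 10`
  push Not at hstatic
  have hk1 : 1 ≤ k := by omega
  have hhd : 3 * k + 8 ≤ hd := by omega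
  -- the demand (r − 3, 3) is legal
  have hfloor : (r - 2) / hd + 1 ≤ 3 := by
    have : (r - 2) / hd ≤ 2 := by
      rw [Nat.div_le_iff_le_mul_add_pred (by omega)]
      omega
    omega
  have hpow : r - 3 ≤ 2 ^ (hd - 1) := by
    have := two_mul_le_two_pow_pred hd (by omega)
    omega
  obtain ⟨f, side, g₀, g₁, hg, hfalse, htrue, hW0, -⟩ :=
    hwin hd r e hW (by omega) (by omega) (r - 3) 3 (by omega) hfloor (by omega) hpow
  set col : Fin r → Bool := fun x => side (e x).1 ((e x).2 (f (e x).1)) with hcol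
  -- `Sum.elim g₀ g₁` is a bijection; `true` columns are exactly the range of `g₁`
  have hsurj : Function.Surjective (Sum.elim g₀ g₁) := by
    have hbij := (Fintype.bijective_iff_injective_and_card _).mpr
      ⟨hg, by simp [Fintype.card_sum, Fintype.card_fin]; omega⟩
    exact hbij.2
  have hg₁inj : Function.Injective g₁ := fun a b h => Sum.inr_injective (hg (by simpa using h))
  have htrue_range : ∀ x, col x = true → x ∈ Set.range g₁ := by
    intro x hx
    obtain ⟨s, hs⟩ := hsurj x
    rcases s with j | j
    · have : col x = false := by rw [← hs]; exact hfalse j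
      rw [hx] at this; exact absurd this (by decide)
    · exact ⟨j, hs⟩
  have hfalse_pre : ∀ x, col x = false → ∃ j, g₀ j = x := by
    intro x hx
    obtain ⟨s, hs⟩ := hsurj x
    rcases s with j | j
    · exact ⟨j, hs⟩
    · have : col x = true := by rw [← hs]; exact htrue j
      rw [hx] at this; exact absurd this (by decide)
  -- partners: in square `l`, flipping the coordinate the chosen slot does not read keeps the colour
  choose c hc using hsq
  have hpartner : ∀ l (z : Fin (1 + 1) → Fin 2), ∃ z', z' ≠ z ∧ col (i l z') = col (i l z) := by
    intro l z
    set p : Fin m := (e (i l fun _ => 0)).1 with hp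
    set c₀ : Fin (1 + 1) := c l (f p) with hc₀
    let z' : Fin (1 + 1) → Fin 2 := Function.update z (c₀ + 1) (z (c₀ + 1) + 1)
    have hne : c₀ + 1 ≠ c₀ := by
      intro h
      have := congrArg (fun x : Fin (1 + 1) => (x : ℕ)) h
      simp [Fin.val_add] at this
      omega
    have hz'c : z' c₀ = z c₀ := by
      simp only [z', Function.update_of_ne hne.symm]
    have hz'ne : z' ≠ z := by
      intro h
      have := congrFun h (c₀ + 1)
      simp only [z', Function.update_self] at this
      have := congrArg (fun x : Fin 2 => (x : ℕ)) this
      simp [Fin.val_add] at this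
      omega
    refine ⟨z', hz'ne, ?_⟩
    have hslot : (e (i l z')).2 (f p) = (e (i l z)).2 (f p) := hc l (f p) z' z hz'c
    simp only [hcol, hpiece l z', hpiece l z, ← hp, hslot]
  -- a square with a `true` column has two distinct `true` columns
  have htwo : ∀ l z, col (i l z) = true → ∃ z', z' ≠ z ∧ col (i l z') = true := by
    intro l z hz
    obtain ⟨z', hne, hcz⟩ := hpartner l z
    exact ⟨z', hne, by rw [hcz, hz]⟩
  -- at most one square has a `true` column
  have hatmost : ∀ l₁ l₂ z₁ z₂, col (i l₁ z₁) = true → col (i l₂ z₂) = true → l₁ = l₂ := by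
    intro l₁ l₂ z₁ z₂ h1 h2
    by_contra hne
    obtain ⟨z₁', hz₁', h1'⟩ := htwo l₁ z₁ h1
    obtain ⟨z₂', hz₂', h2'⟩ := htwo l₂ z₂ h2
    have hd : ∀ (a b : Fin (k + 1) × (Fin (1 + 1) → Fin 2)), a ≠ b → i a.1 a.2 ≠ i b.1 b.2 :=
      fun a b hab h => hab (hinj h)
    exact not_four_mem_range_fin_three g₁ (i l₁ z₁) (i l₁ z₁') (i l₂ z₂) (i l₂ z₂')
      (hd (l₁, z₁) (l₁, z₁') (by simp [Ne.symm hz₁']))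
      (hd (l₁, z₁) (l₂, z₂) (by simp [hne]))
      (hd (l₁, z₁) (l₂, z₂') (by simp [hne]))
      (hd (l₁, z₁') (l₂, z₂) (by simp [hne]))
      (hd (l₁, z₁') (l₂, z₂') (by simp [hne]))
      (hd (l₂, z₂) (l₂, z₂') (by simp [Ne.symm hz₂']))
      (htrue_range _ h1) (htrue_range _ h1') (htrue_range _ h2) (htrue_range _ h2')
  -- choose the square to drop: the one meeting the `true` child if any, else square `0`
  have hex : ∃ l₀ : Fin (k + 1), ∀ l, l ≠ l₀ → ∀ z, col (i l z) = false := by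
    by_cases hbad : ∃ l z, col (i l z) = true
    · obtain ⟨l₀, z₀, h0⟩ := hbad
      refine ⟨l₀, fun l hl z => ?_⟩
      by_contra hz
      have hz' : col (i l z) = true := by
        cases hcz : col (i l z) with
        | true => rfl
        | false => exact absurd hcz hz
      exact hl (hatmost l l₀ z z₀ hz' h0)
    · push Not at hbad
      refine ⟨0, fun l _ z => ?_⟩
      cases hcz : col (i l z) with
      | false => rfl
      | true => exact absurd hcz (hbad l z)
  obtain ⟨l₀, hl₀⟩ := hex
  -- pull the other `k` squares back along `g₀`
  have hpre : ∀ (l : Fin k) (z : Fin (1 + 1) → Fin 2), ∃ j, g₀ j = i (Fin.succAbove l₀ l) z :=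
    fun l z => hfalse_pre _ (hl₀ _ (Fin.succAbove_ne l₀ l) z)
  choose j hj using hpre
  refine IHk hk1 (r - 3) (hd - 1) (fun x => e (g₀ x)) j (by omega) (by omega) ?_ ?_ ?_ hW0
  · rintro ⟨l, z⟩ ⟨l', z'⟩ h
    have h' : i (Fin.succAbove l₀ l) z = i (Fin.succAbove l₀ l') z' := by
      have := congrArg g₀ h
      simpa only [hj] using this
    have := hinj (a₁ := (Fin.succAbove l₀ l, z)) (a₂ := (Fin.succAbove l₀ l', z')) h'
    simp only [Prod.mk.injEq] at this
    exact Prod.ext (Fin.succAbove_right_injective this.1) this.2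
  · intro l z
    simp only [hj]
    exact hpiece _ z
  · intro l φ
    obtain ⟨c', hc'⟩ : ∃ c' : Fin (1 + 1), ∀ z z', z c' = z' c' →
        (e (i (Fin.succAbove l₀ l) z)).2 φ = (e (i (Fin.succAbove l₀ l) z')).2 φ := ⟨c _ φ, hc _ φ⟩
    refine ⟨c', fun z z' hzz => ?_⟩
    simp only [hj]
    exact hc' z z' hzz

end

end Summit.ValiantsHypothesis.ValiantsHypothesis.Theorems.BarrierLever.SimplexJoin.Cut
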